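import Literature.AlgebraicTopology.CharacteristicClasses.LineChernClass
import Literature.AlgebraicTopology.CharacteristicClasses.FibrewiseContinuity
import HarnessLib

/-!
# The first Chern class of a continuous line COCYCLE: pull-back and coboundary / refinement invariance

Topic `Literature/AlgebraicTopology/CharacteristicClasses`, namespace `Literature.AlgebraicTopology.CharacteristicClasses`.
A continuous line cocycle on a topological space `B` — an open cover `(U_i)_{i ∈ ι}` with continuous transition functions
`g_ij : U_i ∩ U_j → GL₁(ℂ)` satisfying `g_jk g_ij = g_ik` (Husemoller, *Fibre Bundles*, Ch. 5 §3 (3.1)–(3.2); Hirzebruch §3.2) —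
is LITERALLY Mathlib's `VectorBundleCore ℂ B ℂ ι`, whose `Fiber`/`TotalSpace` carry the glued line bundle (Husemoller Ch. 5
Thm. 3.2).  This file names its first Chern class and proves the two invariances every «`c₁` of a line bundle given by
transition functions» computation uses:

* `lineBundleOfCore Z : ComplexVectorBundle B` (rank one, `rank_lineBundleOfCore`) and
  **`lineChernClass Z : H²(B; ℤ)`** `:= firstChernClass (lineBundleOfCore Z)` (★ `ComplexVectorBundle.firstChernClass`, the Euler class
  of the Thom class; paracompact Hausdorff `B`);
* `VectorBundleCore.pullbackCore Z f` — the induced cocycle `(f⁻¹U_i, g_ij ∘ f)` along a continuous `f : B′ → B` (Husemoller Ch. 5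
  Prop. 3.3 / (3.4)), for any field and model fibre, and **`lineChernClass_pullbackCore`: `c₁(f^*g) = f^* c₁(g)`** — the induced cocycle's
  bundle is isomorphic to Mathlib's pull-back bundle `f *ᵖ` (★ `VectorBundleCore.continuous_morph`, identity index map), then ★
  `eulerClass_iso` + ★ `eulerClass_pullback`;
* **`lineChernClass_eq_of_cohomologous`** — two line cocycles `g` on `(U_i)_{ι₁}` and `g′` on `(V_k)_{ι₂}` over the SAME base with a
  refinement map `j : ι₁ → ι₂`, `U_i ⊆ V_{j i}`, and continuous non-vanishing `h_i : U_i → ℂˣ` with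
  `g′_{j i, j i′}(b) · h_i(b) = h_{i′}(b) · g_{i i′}(b)` on `U_i ∩ U_{i′}` have the SAME `c₁` (Husemoller Ch. 5 Thm. 3.2 / Prop. 3.5:
  cohomologous cocycles ⇔ isomorphic bundles; Hirzebruch §3.2 (c)): the fibrewise maps `v ↦ g′_{j i, k_b}(b)(h_i(b) v)` (`i`, `k_b` the
  distinguished charts at `b`) form a continuous fibrewise isomorphism (★ `VectorBundleCore.continuous_totalSpace_map`, local expression
  `(b, x) ↦ g′_{j i₀, k₀}(b)(h_{i₀}(b) x)`), then ★ `eulerClass_iso`.  Special cases: `lineChernClass_eq_of_coboundary` (`j = id`) and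
  `lineChernClass_eq_of_refinement` (`h = 1`).

Everything is proved; no named fact, no instance, no notation.  Consumers: the cell `hodgecm-mathlib` (U)-lane, node U-e road (T-top),
leaf (T2) («`c₁` of an algebraic line bundle on complex points», items (L1)–(L3)) and leaf (T3) («`c₁(L(H, χ)) = E` on a complex
torus»); HC_CM is proved only modulo the 7 printed citations until rung 0 closes, and this file discharges none of them.

## References
* [HusemollerFibreBundles1994] D. Husemoller, *Fibre Bundles*, 3rd ed., GTM 20 (1994), Ch. 5 §3 ((3.1)–(3.4), Thm. 3.2, Prop. 3.3,
  Prop. 3.5), Ch. 17 Def. 2.6 and Prop. 3.3 ((C₁)).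
* [Hirzebruch1966] F. Hirzebruch, *Topological Methods in Algebraic Geometry*, 3rd ed. (1966), §3.2 (cocycles, refinements, coboundaries),
  §4.2.
* [MilnorStasheff1974] J. Milnor, J. Stasheff, *Characteristic Classes* (1974), §14 (p. 158: `c₁ = e` for line bundles).
-/

set_option autoImplicit false

noncomputable section

open Bundle Set Filter Topology Function
open Literature.AlgebraicTopology.SingularHomology

/-! ### The induced (pulled-back) cocycle along a continuous map — any field, any model fibre -/

namespace VectorBundleCore

variable {𝕜 : Type*} [NontriviallyNormedField 𝕜] {B B' F : Type*} [TopologicalSpace B] [TopologicalSpace B']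
  [NormedAddCommGroup F] [NormedSpace 𝕜 F] {ι : Type*}

/-- **The induced cocycle `f^*g = (f⁻¹ U_i, g_ij ∘ f)`** of a vector bundle core along a continuous map (Husemoller Ch. 5
Prop. 3.3 / (3.4): the transition functions of the induced bundle are the `g_ij ∘ f`).  A deliberate dot-notation extension of
Mathlib's `VectorBundleCore`. [cite: HusemollerFibreBundles1994, Ch. 5 §3 Prop. 3.3] -/
def pullbackCore (Z : VectorBundleCore 𝕜 B F ι) (f : C(B', B)) : VectorBundleCore 𝕜 B' F ι where
  baseSet i := f ⁻¹' Z.baseSet i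
  isOpen_baseSet i := (Z.isOpen_baseSet i).preimage f.continuous
  indexAt b := Z.indexAt (f b)
  mem_baseSet_at b := Z.mem_baseSet_at (f b)
  coordChange i j b := Z.coordChange i j (f b)
  coordChange_self i b hb v := Z.coordChange_self i (f b) hb v
  continuousOn_coordChange i j :=
    (Z.continuousOn_coordChange i j).comp f.continuous.continuousOn fun _ hb ↦ hb
  coordChange_comp i j k b hb v := Z.coordChange_comp i j k (f b) hb v

variable (Z : VectorBundleCore 𝕜 B F ι) (f : C(B', B))

/-- The charts of `f^*g` are the preimages `f⁻¹ U_i`. [cite: HusemollerFibreBundles1994, Ch. 5 §3 Prop. 3.3] -/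
@[simp]
theorem pullbackCore_baseSet (i : ι) : (Z.pullbackCore f).baseSet i = f ⁻¹' Z.baseSet i := rfl

/-- The transition functions of `f^*g` are `g_ij ∘ f`. [cite: HusemollerFibreBundles1994, Ch. 5 §3 Prop. 3.3] -/
@[simp]
theorem pullbackCore_coordChange (i j : ι) (b : B') : (Z.pullbackCore f).coordChange i j b = Z.coordChange i j (f b) := rfl

/-- The distinguished chart of `f^*g` at `b` is that of `g` at `f b`. [cite: HusemollerFibreBundles1994, Ch. 5 §3 Prop. 3.3] -/
@[simp]
theorem pullbackCore_indexAt (b : B') : (Z.pullbackCore f).indexAt b = Z.indexAt (f b) := rfl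

end VectorBundleCore

namespace Literature.AlgebraicTopology.CharacteristicClasses

/-! ### Scalar reading of a line cocycle -/

section Scalar

variable {B : Type*} [TopologicalSpace B] {ι : Type*} (Z : VectorBundleCore ℂ B ℂ ι)

/-- On the model line `ℂ` a transition map is multiplication by its value at `1` (the transition functions of a line cocycle are
`GL₁(ℂ) = ℂˣ`-valued, Husemoller Ch. 5 (3.1)). [cite: HusemollerFibreBundles1994, Ch. 5 §3 (3.1)] -/
theorem coordChange_apply_eq_mul (i j : ι) (b : B) (v : ℂ) : Z.coordChange i j b v = v * Z.coordChange i j b 1 := by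
  rw [← smul_eq_mul, ← ContinuousLinearMap.map_smul, smul_eq_mul, mul_one]

end Scalar

/-! ### `c₁` is invariant under a fibrewise linear isomorphism with continuous total map (forward direction only) -/

namespace ComplexVectorBundle

variable {B : Type} [TopologicalSpace B] [T2Space B] [ParacompactSpace B]

/-- **(C₁) invariance, one-sided form: `c₁(λ₁) = c₁(λ₂)`** for line bundles related by fibrewise continuous linear equivalences
whose induced map of total spaces `λ₁ → λ₂` is continuous (continuity of the inverse is not needed: the Thom class of `λ₂` pulls back
to the Thom class of `λ₁`, ★ `eulerClass_iso`). [cite: HusemollerFibreBundles1994, Ch. 17 Prop. 3.3] -/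
theorem firstChernClass_eq_of_equiv (L₁ L₂ : ComplexVectorBundle.{0, 0} B) (h₁ : L₁.rank = 1) (h₂ : L₂.rank = 1)
    (φ : ∀ b, L₁.E b ≃L[ℂ] L₂.E b)
    (hφ : Continuous fun q : TotalSpace L₁.F L₁.E ↦ (⟨(ContinuousMap.id B) q.proj, φ q.proj q.2⟩ : TotalSpace L₂.F L₂.E)) :
    L₁.firstChernClass h₁ = L₂.firstChernClass h₂ :=
  eulerClass_iso L₁.F L₁.E (L₁.finrank_eq_one_of_rank h₁) ℤ L₂.F L₂.E (L₂.finrank_eq_one_of_rank h₂) φ hφ 1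

end ComplexVectorBundle

/-! ### The line bundle and the first Chern class of a line cocycle -/

section LineBundle

variable {B : Type} [TopologicalSpace B] {ι : Type*}

/-- **The complex LINE BUNDLE of a line cocycle** `Z : VectorBundleCore ℂ B ℂ ι` (Husemoller Ch. 5 Thm. 3.2: the bundle glued from the
transition functions), bundled as a `ComplexVectorBundle`. [cite: HusemollerFibreBundles1994, Ch. 5 §3 Thm. 3.2] -/
def lineBundleOfCore (Z : VectorBundleCore ℂ B ℂ ι) : ComplexVectorBundle.{0, 0} B where
  F := ℂ
  E := Z.Fiber

/-- The bundle of a line cocycle is a line bundle. [cite: HusemollerFibreBundles1994, Ch. 5 §3 Thm. 3.2] -/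
@[simp]
theorem rank_lineBundleOfCore (Z : VectorBundleCore ℂ B ℂ ι) : (lineBundleOfCore Z).rank = 1 := Module.finrank_self ℂ

/-- The pull-back BUNDLE of the bundle of a cocycle is a line bundle. [cite: HusemollerFibreBundles1994, Ch. 5 §3 Prop. 3.3] -/
@[simp]
theorem rank_pullback_lineBundleOfCore {B' : Type} [TopologicalSpace B'] (Z : VectorBundleCore ℂ B ℂ ι) (f : C(B', B)) :
    ((lineBundleOfCore Z).pullback f).rank = 1 := Module.finrank_self ℂ

variable [T2Space B] [ParacompactSpace B]

/-- **The first Chern class `c₁(g) ∈ H²(B; ℤ)` of a continuous line cocycle** `g = (U_i, g_ij)` over a paracompact Hausdorff base: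
the first Chern class (★ `ComplexVectorBundle.firstChernClass`, Euler class of the Thom class) of its line bundle.
[cite: HusemollerFibreBundles1994, Ch. 17 Def. 2.6] [cite: MilnorStasheff1974, §14 p. 158] -/
def lineChernClass (Z : VectorBundleCore ℂ B ℂ ι) : singularCohomology ℤ ℤ B 2 :=
  (lineBundleOfCore Z).firstChernClass (rank_lineBundleOfCore Z)

/-- `lineChernClass` is the first Chern class of the core's line bundle (unfolding). [cite: MilnorStasheff1974, §14 p. 158] -/
theorem lineChernClass_eq_firstChernClass (Z : VectorBundleCore ℂ B ℂ ι) :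
    lineChernClass Z = (lineBundleOfCore Z).firstChernClass (rank_lineBundleOfCore Z) := rfl

end LineBundle

/-! ### (C₁) naturality: `c₁(f^*g) = f^* c₁(g)` -/

section Pullback

variable {B B' : Type} [TopologicalSpace B] [TopologicalSpace B'] {ι : Type*}
  (Z : VectorBundleCore ℂ B ℂ ι) (f : C(B', B))

/-- **The identity on fibres is a continuous bundle map `(f^*g) → g` over `f`** (same transition functions read along `f`;
★ `VectorBundleCore.continuous_morph` with the identity index map). [cite: HusemollerFibreBundles1994, Ch. 5 §3 Prop. 3.3] -/
theorem continuous_pullbackCore_map :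
    Continuous fun q : (Z.pullbackCore f).TotalSpace ↦
      (⟨f q.proj, (Z.pullbackCore f).morphFiber Z f id q.proj q.2⟩ : Z.TotalSpace) :=
  (Z.pullbackCore f).continuous_morph (Z₂ := Z) (j := id) f.continuous (fun _ _ hb ↦ hb) fun _ _ _ _ _ ↦ rfl

variable [T2Space B] [ParacompactSpace B] [T2Space B'] [ParacompactSpace B']

/-- **(C₁) naturality for cocycles: `c₁(f^*g) = f^* c₁(g)`** — the bundle of the induced cocycle is isomorphic to the pull-back
bundle (Husemoller Ch. 5 Prop. 3.3), and `c₁` is natural (★ `eulerClass_pullback`) and isomorphism invariant (★ `eulerClass_iso`).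
[cite: HusemollerFibreBundles1994, Ch. 17 Prop. 3.3] [cite: HusemollerFibreBundles1994, Ch. 5 §3 Prop. 3.3] -/
theorem lineChernClass_pullbackCore :
    lineChernClass (Z.pullbackCore f) = singularCohomology.map ℤ ℤ f 2 (lineChernClass Z) := by
  have hbase : ∀ i, (Z.pullbackCore f).baseSet i ⊆ f ⁻¹' Z.baseSet (id i) := fun _ _ hb ↦ hb
  -- `(f^*g) ≅ f *ᵖ g` via the morphism of cores with identity index map
  have hcont : Continuous fun q : (Z.pullbackCore f).TotalSpace ↦
      (⟨(ContinuousMap.id B') q.proj, (Z.pullbackCore f).morphEquiv (Z₂ := Z) (f := f) (j := id) hbase q.proj q.2⟩ :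
        TotalSpace ℂ (⇑f *ᵖ Z.Fiber)) := by
    rw [(inducing_pullbackTotalSpaceEmbedding ℂ Z.Fiber ⇑f).continuous_iff]
    exact (FiberBundle.continuous_proj ℂ _).prodMk (continuous_pullbackCore_map Z f)
  rw [lineChernClass_eq_firstChernClass, lineChernClass_eq_firstChernClass,
    ← (lineBundleOfCore Z).firstChernClass_pullback f (rank_lineBundleOfCore Z)]
  exact ComplexVectorBundle.firstChernClass_eq_of_equiv (lineBundleOfCore (Z.pullbackCore f))
    ((lineBundleOfCore Z).pullback f) _ _
    (fun b ↦ (Z.pullbackCore f).morphEquiv (Z₂ := Z) (f := f) (j := id) hbase b) hcont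

end Pullback

/-! ### Cohomologous cocycles (coboundaries and refinements) have the same `c₁` -/

section Cohomologous

variable {B : Type} [TopologicalSpace B] {ι₁ ι₂ : Type*}
  (Z₁ : VectorBundleCore ℂ B ℂ ι₁) (Z₂ : VectorBundleCore ℂ B ℂ ι₂) (j : ι₁ → ι₂) (h : ι₁ → B → ℂ)

/-- The fibrewise map of a cohomology of cocycles `(j, h) : g → g′`: a vector of `g` at `b`, read in the distinguished chart `i_b`, is
rescaled by `h_{i_b}(b)`, placed in the chart `j i_b` of `g′`, and re-read in the distinguished chart of `g′` at `b`
(Husemoller Ch. 5 Prop. 3.5; Hirzebruch §3.2 (c)). [cite: HusemollerFibreBundles1994, Ch. 5 §3 Prop. 3.5] -/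
def cohomologousFiber (b : B) : ℂ →L[ℂ] ℂ :=
  (Z₂.coordChange (j (Z₁.indexAt b)) (Z₂.indexAt b) b).comp (ContinuousLinearMap.lsmul ℂ ℂ (h (Z₁.indexAt b) b))

/-- Value of the fibrewise map. [cite: HusemollerFibreBundles1994, Ch. 5 §3 Prop. 3.5] -/
@[simp]
theorem cohomologousFiber_apply (b : B) (v : ℂ) :
    cohomologousFiber Z₁ Z₂ j h b v = Z₂.coordChange (j (Z₁.indexAt b)) (Z₂.indexAt b) b (h (Z₁.indexAt b) b * v) := rfl

/-- The inverse fibrewise map `w ↦ h_{i_b}(b)⁻¹ · g′_{k_b, j i_b}(b) w`. [cite: HusemollerFibreBundles1994, Ch. 5 §3 Prop. 3.5] -/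
def cohomologousFiberInv (b : B) : ℂ →L[ℂ] ℂ :=
  (ContinuousLinearMap.lsmul ℂ ℂ (h (Z₁.indexAt b) b)⁻¹).comp (Z₂.coordChange (Z₂.indexAt b) (j (Z₁.indexAt b)) b)

/-- Value of the inverse fibrewise map. [cite: HusemollerFibreBundles1994, Ch. 5 §3 Prop. 3.5] -/
@[simp]
theorem cohomologousFiberInv_apply (b : B) (w : ℂ) :
    cohomologousFiberInv Z₁ Z₂ j h b w = (h (Z₁.indexAt b) b)⁻¹ * Z₂.coordChange (Z₂.indexAt b) (j (Z₁.indexAt b)) b w := rfl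

variable {Z₁ Z₂ j h}

/-- `inv ∘ map = id` on the line, when `h` does not vanish and the charts are compatible. [cite: HusemollerFibreBundles1994, Ch. 5 §3 Prop. 3.5] -/
theorem cohomologousFiberInv_cohomologousFiber (hbase : ∀ i, Z₁.baseSet i ⊆ Z₂.baseSet (j i))
    (h0 : ∀ i b, b ∈ Z₁.baseSet i → h i b ≠ 0) (b : B) (v : ℂ) :
    cohomologousFiberInv Z₁ Z₂ j h b (cohomologousFiber Z₁ Z₂ j h b v) = v := by
  have hb₁ : b ∈ Z₁.baseSet (Z₁.indexAt b) := Z₁.mem_baseSet_at b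
  have hb₂ : b ∈ Z₂.baseSet (j (Z₁.indexAt b)) := hbase _ hb₁
  have hb₃ : b ∈ Z₂.baseSet (Z₂.indexAt b) := Z₂.mem_baseSet_at b
  rw [cohomologousFiberInv_apply, cohomologousFiber_apply, Z₂.coordChange_comp _ _ _ _ ⟨⟨hb₂, hb₃⟩, hb₂⟩,
    Z₂.coordChange_self _ _ hb₂, ← mul_assoc, inv_mul_cancel₀ (h0 _ _ hb₁), one_mul]

/-- `map ∘ inv = id` on the line. [cite: HusemollerFibreBundles1994, Ch. 5 §3 Prop. 3.5] -/
theorem cohomologousFiber_cohomologousFiberInv (hbase : ∀ i, Z₁.baseSet i ⊆ Z₂.baseSet (j i))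
    (h0 : ∀ i b, b ∈ Z₁.baseSet i → h i b ≠ 0) (b : B) (w : ℂ) :
    cohomologousFiber Z₁ Z₂ j h b (cohomologousFiberInv Z₁ Z₂ j h b w) = w := by
  have hb₁ : b ∈ Z₁.baseSet (Z₁.indexAt b) := Z₁.mem_baseSet_at b
  have hb₂ : b ∈ Z₂.baseSet (j (Z₁.indexAt b)) := hbase _ hb₁
  have hb₃ : b ∈ Z₂.baseSet (Z₂.indexAt b) := Z₂.mem_baseSet_at b
  rw [cohomologousFiber_apply, cohomologousFiberInv_apply, ← mul_assoc, mul_inv_cancel₀ (h0 _ _ hb₁), one_mul,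
    Z₂.coordChange_comp _ _ _ _ ⟨⟨hb₃, hb₂⟩, hb₃⟩, Z₂.coordChange_self _ _ hb₃]

/-- The fibrewise map of a cohomology of cocycles as a continuous linear equivalence of the line.
[cite: HusemollerFibreBundles1994, Ch. 5 §3 Prop. 3.5] -/
def cohomologousEquiv (hbase : ∀ i, Z₁.baseSet i ⊆ Z₂.baseSet (j i)) (h0 : ∀ i b, b ∈ Z₁.baseSet i → h i b ≠ 0) (b : B) :
    ℂ ≃L[ℂ] ℂ :=
  ContinuousLinearEquiv.equivOfInverse (cohomologousFiber Z₁ Z₂ j h b) (cohomologousFiberInv Z₁ Z₂ j h b)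
    (cohomologousFiberInv_cohomologousFiber hbase h0 b) (cohomologousFiber_cohomologousFiberInv hbase h0 b)

/-- `cohomologousEquiv` is `cohomologousFiber`. [cite: HusemollerFibreBundles1994, Ch. 5 §3 Prop. 3.5] -/
@[simp]
theorem cohomologousEquiv_apply (hbase : ∀ i, Z₁.baseSet i ⊆ Z₂.baseSet (j i)) (h0 : ∀ i b, b ∈ Z₁.baseSet i → h i b ≠ 0)
    (b : B) (v : ℂ) : cohomologousEquiv hbase h0 b v = cohomologousFiber Z₁ Z₂ j h b v := rfl

/-- **A cohomology of cocycles induces a continuous fibrewise map of the glued bundles** (Husemoller Ch. 5 Prop. 3.5): in the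
distinguished charts at `b₀` the map `⟨b, v⟩ ↦ ⟨b, cohomologousFiber b v⟩` reads `(b, x) ↦ g′_{j i₀, k₀}(b) (h_{i₀}(b) x)`, continuous
near `b₀` since `h_{i₀}` is continuous on `U_{i₀}` and `g′` on `V_{j i₀} ∩ V_{k₀}`.
[cite: HusemollerFibreBundles1994, Ch. 5 §3 Prop. 3.5] [cite: Hirzebruch1966, §3.2] -/
theorem continuous_cohomologousFiber (hbase : ∀ i, Z₁.baseSet i ⊆ Z₂.baseSet (j i))
    (hc : ∀ i, ContinuousOn (h i) (Z₁.baseSet i))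
    (hcob : ∀ i i' b, b ∈ Z₁.baseSet i ∩ Z₁.baseSet i' →
      Z₂.coordChange (j i) (j i') b 1 * h i b = h i' b * Z₁.coordChange i i' b 1) :
    Continuous fun q : Z₁.TotalSpace ↦ (⟨q.proj, cohomologousFiber Z₁ Z₂ j h q.proj q.2⟩ : Z₂.TotalSpace) := by
  refine Z₁.continuous_totalSpace_map Z₂ continuous_id (fun b v ↦ cohomologousFiber Z₁ Z₂ j h b v) fun b₀ x₀ ↦ ?_
  -- neighbourhood of `b₀` where all charts in play contain `b`
  have hN : ∀ᶠ q : B × ℂ in 𝓝 (b₀, x₀),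
      q.1 ∈ Z₁.baseSet (Z₁.indexAt b₀) ∧ q.1 ∈ Z₂.baseSet (Z₂.indexAt b₀) :=
    (continuousAt_fst (p := (b₀, x₀))).preimage_mem_nhds
      (Filter.inter_mem ((Z₁.isOpen_baseSet _).mem_nhds (Z₁.mem_baseSet_at b₀))
        ((Z₂.isOpen_baseSet _).mem_nhds (Z₂.mem_baseSet_at b₀)))
  -- the local expression `(b, x) ↦ g′_{j i₀, k₀}(b) (h_{i₀}(b) x)` is continuous at `(b₀, x₀)`
  have hA : ContinuousAt (fun b ↦ Z₂.coordChange (j (Z₁.indexAt b₀)) (Z₂.indexAt b₀) b) b₀ := by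
    refine (Z₂.continuousOn_coordChange _ _).continuousAt ?_
    exact Filter.inter_mem ((Z₂.isOpen_baseSet _).mem_nhds (hbase _ (Z₁.mem_baseSet_at b₀)))
      ((Z₂.isOpen_baseSet _).mem_nhds (Z₂.mem_baseSet_at b₀))
  have hH : ContinuousAt (fun b ↦ h (Z₁.indexAt b₀) b) b₀ :=
    (hc _).continuousAt ((Z₁.isOpen_baseSet _).mem_nhds (Z₁.mem_baseSet_at b₀))
  have hloc : ContinuousAt (fun q : B × ℂ ↦
      Z₂.coordChange (j (Z₁.indexAt b₀)) (Z₂.indexAt b₀) q.1 (h (Z₁.indexAt b₀) q.1 * q.2)) (b₀, x₀) :=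
    (hA.comp continuousAt_fst).clm_apply ((hH.comp continuousAt_fst).mul continuousAt_snd)
  refine hloc.congr_of_eventuallyEq ?_
  filter_upwards [hN] with q hq
  obtain ⟨hq₁, hq₂⟩ := hq
  -- abbreviations for the charts in play
  have hb₁ : q.1 ∈ Z₁.baseSet (Z₁.indexAt q.1) := Z₁.mem_baseSet_at q.1
  have hb₂ : q.1 ∈ Z₂.baseSet (j (Z₁.indexAt q.1)) := hbase _ hb₁
  have hb₃ : q.1 ∈ Z₂.baseSet (Z₂.indexAt q.1) := Z₂.mem_baseSet_at q.1
  have hb₄ : q.1 ∈ Z₂.baseSet (j (Z₁.indexAt b₀)) := hbase _ hq₁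
  change Z₂.coordChange (Z₂.indexAt q.1) (Z₂.indexAt b₀) q.1
      (cohomologousFiber Z₁ Z₂ j h q.1 (Z₁.coordChange (Z₁.indexAt b₀) (Z₁.indexAt q.1) q.1 q.2)) =
    Z₂.coordChange (j (Z₁.indexAt b₀)) (Z₂.indexAt b₀) q.1 (h (Z₁.indexAt b₀) q.1 * q.2)
  rw [cohomologousFiber_apply, Z₂.coordChange_comp _ _ _ _ ⟨⟨hb₂, hb₃⟩, hq₂⟩]
  have harg : h (Z₁.indexAt q.1) q.1 * Z₁.coordChange (Z₁.indexAt b₀) (Z₁.indexAt q.1) q.1 q.2 =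
      Z₂.coordChange (j (Z₁.indexAt b₀)) (j (Z₁.indexAt q.1)) q.1 (h (Z₁.indexAt b₀) q.1 * q.2) := by
    rw [coordChange_apply_eq_mul Z₁, coordChange_apply_eq_mul Z₂ _ _ _ (h _ q.1 * q.2)]
    have hrel := hcob _ _ _ ⟨hq₁, hb₁⟩
    linear_combination (-q.2) * hrel
  rw [harg, Z₂.coordChange_comp _ _ _ _ ⟨⟨hb₄, hb₂⟩, hq₂⟩]

variable [T2Space B] [ParacompactSpace B]

/-- **Cohomologous line cocycles have the same first Chern class** (Husemoller Ch. 5 Thm. 3.2 / Prop. 3.5: cohomologous cocycles, through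
a refinement `j` of the covers and continuous non-vanishing `h_i : U_i → ℂˣ` with `g′_{j i, j i′} · h_i = h_{i′} · g_{i i′}`, glue to
isomorphic line bundles; ★ `eulerClass_iso`). [cite: HusemollerFibreBundles1994, Ch. 5 §3 Thm. 3.2] [cite: Hirzebruch1966, §3.2] -/
theorem lineChernClass_eq_of_cohomologous (hbase : ∀ i, Z₁.baseSet i ⊆ Z₂.baseSet (j i))
    (hc : ∀ i, ContinuousOn (h i) (Z₁.baseSet i)) (h0 : ∀ i b, b ∈ Z₁.baseSet i → h i b ≠ 0)
    (hcob : ∀ i i' b, b ∈ Z₁.baseSet i ∩ Z₁.baseSet i' →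
      Z₂.coordChange (j i) (j i') b 1 * h i b = h i' b * Z₁.coordChange i i' b 1) :
    lineChernClass Z₁ = lineChernClass Z₂ := by
  have hcont : Continuous fun q : Z₁.TotalSpace ↦
      (⟨(ContinuousMap.id B) q.proj, cohomologousEquiv hbase h0 q.proj q.2⟩ : Z₂.TotalSpace) :=
    (continuous_cohomologousFiber hbase hc hcob).congr fun _ ↦ rfl
  exact ComplexVectorBundle.firstChernClass_eq_of_equiv (lineBundleOfCore Z₁) (lineBundleOfCore Z₂) _ _
    (fun b ↦ cohomologousEquiv hbase h0 b) hcont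

/-- **Coboundary invariance** (same cover): `g′_{i i′} · h_i = h_{i′} · g_{i i′}` with continuous non-vanishing `h_i` on `U_i` ⇒
`c₁(g) = c₁(g′)`. [cite: HusemollerFibreBundles1994, Ch. 5 §3 Thm. 3.2] [cite: Hirzebruch1966, §3.2] -/
theorem lineChernClass_eq_of_coboundary {ι : Type*} (Z Z' : VectorBundleCore ℂ B ℂ ι) (hU : ∀ i, Z.baseSet i ⊆ Z'.baseSet i)
    (h : ι → B → ℂ) (hc : ∀ i, ContinuousOn (h i) (Z.baseSet i)) (h0 : ∀ i b, b ∈ Z.baseSet i → h i b ≠ 0)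
    (hcob : ∀ i i' b, b ∈ Z.baseSet i ∩ Z.baseSet i' → Z'.coordChange i i' b 1 * h i b = h i' b * Z.coordChange i i' b 1) :
    lineChernClass Z = lineChernClass Z' :=
  lineChernClass_eq_of_cohomologous (j := id) hU hc h0 hcob

/-- **Refinement invariance**: restricting a cocycle `g′` on `(V_k)` to a refinement `U_i ⊆ V_{j i}` (`g_{i i′} = g′_{j i, j i′}` on
`U_i ∩ U_{i′}`) does not change `c₁`. [cite: Hirzebruch1966, §3.2] [cite: HusemollerFibreBundles1994, Ch. 5 §3 Thm. 3.2] -/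
theorem lineChernClass_eq_of_refinement (hbase : ∀ i, Z₁.baseSet i ⊆ Z₂.baseSet (j i))
    (hres : ∀ i i' b, b ∈ Z₁.baseSet i ∩ Z₁.baseSet i' → Z₁.coordChange i i' b 1 = Z₂.coordChange (j i) (j i') b 1) :
    lineChernClass Z₁ = lineChernClass Z₂ :=
  lineChernClass_eq_of_cohomologous (h := fun _ _ ↦ 1) hbase (fun _ ↦ continuousOn_const) (fun _ _ _ ↦ one_ne_zero)
    fun i i' b hb ↦ by rw [mul_one, one_mul, hres i i' b hb]

end Cohomologous

end Literature.AlgebraicTopology.CharacteristicClasses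

end
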